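import Summits.HodgeConjecture.HodgeConjecture.Theorems.SmoothHypersurfaceTopFormsOnChart
import Summits.HodgeConjecture.HodgeConjecture.Theorems.SmoothHypersurfaceNormalFormCharts
import Literature.AlgebraicGeometry.HodgeTheory.SmoothHypersurfaceGeometricGenusLowerBound
import Literature.Geometry.Kaehler.HolomorphicFormsInCharts
import Mathlib.RingTheory.Nullstellensatz

/-!
# Holomorphic top forms on a smooth hypersurface are Griffiths residues (model in transversal normal form)

Prover seat `hodge-nonav-prover-Bx` (g11), cell `hodge-nonav`, programme PG-GENERAL (discharge of PG =
`Arapura2012_hypersurface_geometricGenus`; stmt-HodgeConjecture-19716 `stub_genusBoundThreefold`, stmt-HodgeConjecture-19544).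
Setting: `G` homogeneous of degree `d ≥ m + 2`, PRIME, in the normal form of the tree's
`TransversalLine.exists_linSubst_transversal_line` (`G(e₀) ≠ 0`; `g(t) = G(t, 1, 0, …, 0)` with simple roots); `M` a
compact complex manifold charted on `E` (`dim_ℂ E = m ≥ 1`); `ψ : M → ℙ(ℂ^{m+2})` a topological embedding ONTO `V(G)`
with holomorphic affine coordinates and non-vanishing gradient on the cone.

* `eq_of_residueForm_eq_on_inter` — two residue representatives of the same form on two charts agree (a form of degree
  `< d` vanishing on `V(G) ∩ {x_a x_b ≠ 0}` is divisible by `G` — Nullstellensatz — hence zero);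
* `exists_eq_residueForm` — **every holomorphic `m`-form on `M` is `ψ^* Res(QΩ/G)`** for a unique `Q ∈ S^{d-m-2}`: the
  charts `{x_l ≠ 0}`, `l ≥ 2`, are in Noether normal form (`SmoothHypersurfaceNormalFormCharts`), so on each of them
  the form is a residue (`SmoothHypersurfaceTopFormsOnChart.exists_eq_residueForm_on_liftDomain`, Serre's
  algebraisation lemma); the representatives agree; the charts cover `M` up to the finitely many points over the
  transversal line `{x₂ = ⋯ = x_{m+1} = 0}`, across which the identity extends by continuity in a chart;
* `finrank_holFormsInCharts_le` — hence **`dim_ℂ {holomorphic m-forms on M} ≤ dim S^{d-m-2} = C(d-1, m+1)`**.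

Sorry-free; no definition, no named fact; helper (`--supports stmt-HodgeConjecture-19716 --as helper`); nothing here says
HC ∕ HC_AV is proved. (Voisin II Cor. 6.12 at `p = 1` ∕ Griffiths 1969 §8: `H^{m,0}(X) ≅ S^{d-m-2}`, surjectivity half.)
-/

noncomputable section

set_option linter.dupNamespace false

open scoped Manifold ContDiff Topology LinearAlgebra.Projectivization
open Set Filter Function Projectivization Polynomial

namespace Summit.HodgeConjecture.HodgeConjecture.Theorems.SmoothHypersurfaceTopFormsResidues

open Literature.AlgebraicGeometry.HodgeTheory Literature.NumberTheory.Transcendental Literature.Geometry.Kaehler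
  Summit.HodgeConjecture.HodgeConjecture.Theorems.SmoothHypersurfaceTopFormsOnChart
  Summit.HodgeConjecture.HodgeConjecture.Theorems.SmoothHypersurfaceNormalFormCharts

variable {m : ℕ} {E : Type*} [NormedAddCommGroup E] [NormedSpace ℂ E] [FiniteDimensional ℂ E]
  {M : Type*} [TopologicalSpace M] [ChartedSpace E M] [IsManifold 𝓘(ℂ, E) ω M] [IsManifold 𝓘(ℝ, E) ∞ M]
  (ψ : M → ℙ ℂ (Fin (m + 2) → ℂ)) {G : MvPolynomial (Fin (m + 2)) ℂ} {d : ℕ}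

/-! ### Representatives on two charts agree -/

omit [FiniteDimensional ℂ E] [TopologicalSpace M] [ChartedSpace E M] [IsManifold 𝓘(ℂ, E) ω M]
  [IsManifold 𝓘(ℝ, E) ∞ M] in
/-- **A form of degree `k < d` vanishing at the normalised lifts of the points of `M_a ∩ M_b` is zero** (`G` prime of
degree `d`, `ψ` onto `V(G)`, `m ≥ 1` so that `k + 2 < d`... precisely `k + 2 ≤ d - m < d`): `R · x_a · x_b` vanishes on
the cone of `G`, hence `G ∣ R x_a x_b` by the Nullstellensatz, and the degree forces `R x_a x_b = 0`.
[cite: VoisinHodgeII2003, §6.1.3 Cor. 6.12 (p = 1)] -/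
theorem eq_zero_of_eval_projLift_eq_zero [NeZero m] (hG : G.IsHomogeneous d) (hprime : Prime G) (hd : m + 2 ≤ d)
    (hrange : Set.range ψ = projZeroLocus {G})
    {R : MvPolynomial (Fin (m + 2)) ℂ} (hR : R.IsHomogeneous (d - (m + 2))) {a b : Fin (m + 2)}
    (hvan : ∀ x ∈ liftDomain ψ a ∩ liftDomain ψ b, MvPolynomial.eval (projLift ψ a x) R = 0) : R = 0 := by
  classical
  have hG0 : G ≠ 0 := hprime.ne_zero
  have hS : ∀ G' ∈ ({G} : Set (MvPolynomial (Fin (m + 2)) ℂ)), G'.IsHomogeneous G'.totalDegree := by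
    rintro G' rfl; rwa [hG.totalDegree hG0]
  set T : MvPolynomial (Fin (m + 2)) ℂ := R * MvPolynomial.X a * MvPolynomial.X b with hT
  -- `T` vanishes on the cone of `G`
  have hTvan : ∀ z : Fin (m + 2) → ℂ, MvPolynomial.eval z G = 0 → MvPolynomial.eval z T = 0 := by
    intro z hzG
    simp only [hT, map_mul, MvPolynomial.eval_X]
    by_cases hz : z = 0
    · simp [hz]
    by_cases hza : z a = 0
    · rw [hza, mul_zero, zero_mul]
    by_cases hzb : z b = 0
    · rw [hzb, mul_zero]
    have hmem : Projectivization.mk ℂ z hz ∈ projZeroLocus {G} :=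
      (mem_projZeroLocus_mk_iff hS z hz).mpr fun G' hG' ↦ by rw [Set.mem_singleton_iff.mp hG']; exact hzG
    rw [← hrange] at hmem
    obtain ⟨x, hx⟩ := hmem
    have hxa : x ∈ liftDomain ψ a := by
      rw [mem_liftDomain_iff, hx, stdChart_source, mk_mem_stdChartSource_iff]; exact hza
    have hxb : x ∈ liftDomain ψ b := by
      rw [mem_liftDomain_iff, hx, stdChart_source, mk_mem_stdChartSource_iff]; exact hzb
    have hRx := hvan x ⟨hxa, hxb⟩
    -- `z = c • Z̃_a x`
    have hmk := (mk_projLift ψ hxa).trans hx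
    rw [Projectivization.mk_eq_mk_iff] at hmk
    obtain ⟨c, hc⟩ := hmk
    have hz' : z = (c⁻¹ : ℂˣ) • projLift ψ a x := by rw [← hc, smul_smul, inv_mul_cancel, one_smul]
    rw [hz', Units.smul_def, eval_smul_of_isHomogeneous hR, hRx, mul_zero, zero_mul, zero_mul]
  -- Nullstellensatz
  have hmemV : T ∈ MvPolynomial.vanishingIdeal ℂ (MvPolynomial.zeroLocus ℂ (Ideal.span {G})) := by
    rw [MvPolynomial.mem_vanishingIdeal_iff]
    intro z hz
    rw [MvPolynomial.mem_zeroLocus_iff] at hz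
    change MvPolynomial.eval z T = 0
    exact hTvan z (hz G (Ideal.subset_span rfl))
  rw [MvPolynomial.vanishingIdeal_zeroLocus_eq_radical,
    ((Ideal.span_singleton_prime hprime.ne_zero).mpr hprime).radical, Ideal.mem_span_singleton] at hmemV
  by_contra hR0
  have hT0 : T ≠ 0 := by
    simp only [hT]
    exact mul_ne_zero (mul_ne_zero hR0 (MvPolynomial.X_ne_zero a)) (MvPolynomial.X_ne_zero b)
  obtain ⟨U, hU⟩ := hmemV
  have hU0 : U ≠ 0 := by rintro rfl; exact hT0 (by rw [hU, mul_zero])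
  have hdeg := MvPolynomial.totalDegree_mul_of_isDomain hprime.ne_zero hU0
  rw [← hU, hG.totalDegree hG0] at hdeg
  have hTdeg : T.totalDegree ≤ d - (m + 2) + 1 + 1 := by
    refine (MvPolynomial.totalDegree_mul _ _).trans (add_le_add ((MvPolynomial.totalDegree_mul _ _).trans
      (add_le_add hR.totalDegree_le ?_)) ?_) <;> simp [MvPolynomial.totalDegree_X]
  have hm : 1 ≤ m := Nat.one_le_iff_ne_zero.mpr (NeZero.ne m)
  omega

omit [IsManifold 𝓘(ℝ, E) ∞ M] in
/-- **Residue representatives on two charts agree**: if `η = ψ^* Res(Q₁Ω/G)` on `M_a` and `η = ψ^* Res(Q₂Ω/G)` on `M_b`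
(`Q₁, Q₂ ∈ S^{d-m-2}`) then `Q₁ = Q₂`. [cite: VoisinHodgeII2003, §6.1.3 Cor. 6.12 (p = 1)] -/
theorem eq_of_residueForm_eq_on_charts [NeZero m] (hG : G.IsHomogeneous d) (hprime : Prime G) (hd : m + 2 ≤ d)
    (hψ : Topology.IsEmbedding ψ) (hrange : Set.range ψ = projZeroLocus {G})
    (hjac : ∀ z : Fin (m + 2) → ℂ, z ≠ 0 → MvPolynomial.eval z G = 0 →
      ∃ j, MvPolynomial.eval z (MvPolynomial.pderiv j G) ≠ 0)
    (hhol : HasHolomorphicCoords E ψ) (hdim : Module.finrank ℂ E = m)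
    {η : MForm 𝓘(ℝ, E) M ℂ m} {Q₁ Q₂ : MvPolynomial (Fin (m + 2)) ℂ}
    (hQ₁ : Q₁.IsHomogeneous (d - (m + 2))) (hQ₂ : Q₂.IsHomogeneous (d - (m + 2))) {a b : Fin (m + 2)}
    (h₁ : ∀ x ∈ liftDomain ψ a, η x = residueForm (E := E) ψ G Q₁ x)
    (h₂ : ∀ x ∈ liftDomain ψ b, η x = residueForm (E := E) ψ G Q₂ x) : Q₁ = Q₂ := by
  have hR : (Q₁ - Q₂).IsHomogeneous (d - (m + 2)) := hQ₁.sub hQ₂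
  have h := eq_zero_of_eval_projLift_eq_zero ψ hG hprime hd hrange hR (a := a) (b := b) fun x hx ↦ by
    have hρ : residueForm (E := E) ψ G (MvPolynomial.X a ^ (d - (m + 2))) x ≠ 0 :=
      residueForm_ne_zero ψ hG hψ hrange.le hjac hhol hdim hd hx.1
    have heq : residueForm (E := E) ψ G Q₁ x = residueForm (E := E) ψ G Q₂ x := by rw [← h₁ x hx.1, ← h₂ x hx.2]
    rw [residueForm_eq_eval_smul ψ hQ₁ hx.1, residueForm_eq_eval_smul ψ hQ₂ hx.1] at heq
    have hsub : (MvPolynomial.eval (projLift ψ a x) Q₁ - MvPolynomial.eval (projLift ψ a x) Q₂) •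
        residueForm (E := E) ψ G (MvPolynomial.X a ^ (d - (m + 2))) x = 0 := by
      rw [sub_smul, heq, sub_self]
    rw [map_sub]
    exact (smul_eq_zero.mp hsub).resolve_right hρ
  exact sub_eq_zero.mp h


/-! ### Extension across finitely many points -/

omit [FiniteDimensional ℂ E] [IsManifold 𝓘(ℂ, E) ω M] in
/-- **A holomorphic-in-charts form vanishing off a finite set vanishes** (`dim_ℂ E ≥ 1`): in the chart at a point of
the finite set, the analytic representative vanishes on the complement of a finite set near the centre, hence at
the centre by continuity. [cite: Huybrechts2005, Def. 2.2.14] -/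
theorem eq_zero_of_eq_zero_off_finite [NeZero m] (hdim : Module.finrank ℂ E = m) {θ : MForm 𝓘(ℝ, E) M ℂ m}
    (hθ : IsHolomorphicInCharts θ) {S : Set M} (hS : S.Finite) (h : ∀ x ∉ S, θ x = 0) (x : M) : θ x = 0 := by
  classical
  by_cases hx : x ∈ S
  swap
  · exact h x hx
  haveI : Nontrivial E := Module.nontrivial_of_finrank_pos (R := ℂ) (by rw [hdim]; exact Nat.pos_of_ne_zero (NeZero.ne m))
  haveI : ∀ y : E, (𝓝[≠] y).NeBot := fun y ↦ Module.punctured_nhds_neBot ℂ E y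
  set φ := extChartAt 𝓘(ℝ, E) x with hφ
  set c := φ x with hc
  obtain ⟨gx, hga, hgeq⟩ := hθ x
  -- the representative vanishes near `c` off the finite set `φ (S ∩ source)`
  set T : Set E := φ '' (S ∩ φ.source) with hT
  have hTfin : T.Finite := (hS.inter_of_left _).image _
  have hzero : ∀ᶠ y in 𝓝[Tᶜ] c, gx y = 0 := by
    have h1 : ∀ᶠ y in 𝓝[Tᶜ] c, θ.inChart x y = (gx y).restrictScalars ℝ := nhdsWithin_le_nhds hgeq
    have h2 : ∀ᶠ y in 𝓝[Tᶜ] c, y ∈ φ.target := nhdsWithin_le_nhds (extChartAt_target_mem_nhds (I := 𝓘(ℝ, E)) x)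
    filter_upwards [h1, h2, self_mem_nhdsWithin] with y hy hyt hyT
    have hyS : φ.symm y ∉ S := by
      intro hmem
      apply hyT
      refine ⟨φ.symm y, ⟨hmem, φ.map_target hyt⟩, φ.right_inv hyt⟩
    have hθy : θ (φ.symm y) = 0 := h _ hyS
    have hin : θ.inChart x y = 0 := by
      ext v
      rw [MForm.inChart_apply]
      have : θ ((extChartAt 𝓘(ℝ, E) x).symm y) = 0 := hθy
      rw [this]
      rfl
    rw [hin] at hy
    have : gx y = 0 := by
      ext v
      have := congrArg (fun L : E [⋀^Fin m]→L[ℝ] ℂ ↦ L v) hy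
      simpa using this.symm
    exact this
  -- continuity at `c` along the dense set `Tᶜ`
  have hdense : Dense Tᶜ := by rw [Set.compl_eq_univ_sdiff]; exact dense_univ.sdiff_finite hTfin
  haveI : (𝓝[Tᶜ] c).NeBot := mem_closure_iff_nhdsWithin_neBot.mp (hdense c)
  have hlim : Tendsto gx (𝓝[Tᶜ] c) (𝓝 (gx c)) := hga.continuousAt.continuousWithinAt.tendsto
  have hlim0 : Tendsto gx (𝓝[Tᶜ] c) (𝓝 0) := tendsto_const_nhds.congr' (hzero.mono fun y hy ↦ hy.symm)
  have hgc : gx c = 0 := tendsto_nhds_unique hlim hlim0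
  have h1 : θ x = (gx c).restrictScalars ℝ := by
    rw [← MForm.inChart_apply_self θ x]; exact hgeq.self_of_nhds
  rw [h1, hgc]
  ext v
  rfl

/-! ### The global statement -/

/-- **Every holomorphic top form on a smooth hypersurface model in transversal normal form is a Griffiths residue.**
[cite: VoisinHodgeII2003, §6.1.3 Cor. 6.12 (p = 1)] [cite: SerreGAGA1956, n° 19–20] -/
theorem exists_eq_residueForm [CompactSpace M] [Nonempty M] [NeZero m] (hG : G.IsHomogeneous d) (hprime : Prime G)
    (hψ : Topology.IsEmbedding ψ) (hrange : Set.range ψ = projZeroLocus {G})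
    (hjac : ∀ z : Fin (m + 2) → ℂ, z ≠ 0 → MvPolynomial.eval z G = 0 →
      ∃ j, MvPolynomial.eval z (MvPolynomial.pderiv j G) ≠ 0)
    (hhol : HasHolomorphicCoords E ψ) (hdim : Module.finrank ℂ E = m) (hd : m + 2 ≤ d)
    (hG0 : MvPolynomial.eval (Pi.single (0 : Fin (m + 2)) (1 : ℂ)) G ≠ 0) {g : ℂ[X]} (hg0 : g ≠ 0)
    (hg : ∀ t : ℂ, g.eval t = MvPolynomial.eval (Fin.cons t (Pi.single (0 : Fin (m + 1)) (1 : ℂ)) : Fin (m + 2) → ℂ) G)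
    (hsimple : ∀ t : ℂ, g.eval t = 0 → (Polynomial.derivative g).eval t ≠ 0)
    {η : MForm 𝓘(ℝ, E) M ℂ m} (hη : IsHolomorphicInCharts η) :
    ∃ Q : MvPolynomial (Fin (m + 2)) ℂ, Q.IsHomogeneous (d - (m + 2)) ∧ η = residueForm (E := E) ψ G Q := by
  classical
  -- residue representatives on the charts `{x_{i₁+1} ≠ 0}`, `i₁ ≠ 0`
  have hchart : ∀ i₁ : Fin (m + 1), i₁ ≠ 0 → ∃ Q : MvPolynomial (Fin (m + 2)) ℂ, Q.IsHomogeneous (d - (m + 2)) ∧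
      ∀ x ∈ liftDomain ψ i₁.succ, η x = residueForm (E := E) ψ G Q x := fun i₁ hi₁ ↦
    exists_eq_residueForm_on_liftDomain ψ hG hψ hrange hjac hhol hdim hd i₁.succ hG0 (normalForm_lead hG i₁)
      ⟨Pi.single 0 1, normalForm_topFamily_roots_nodup hG hi₁ hg0 hg hsimple⟩ hη
  have hlast : (Fin.last m) ≠ 0 := by
    intro h0
    have := congrArg Fin.val h0
    simp at this
    exact NeZero.ne m this
  obtain ⟨Q, hQ, hQη⟩ := hchart (Fin.last m) hlast
  refine ⟨Q, hQ, ?_⟩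
  -- `η = Res(QΩ/G)` on every chart `{x_{i₁+1} ≠ 0}`, `i₁ ≠ 0`
  have hall : ∀ i₁ : Fin (m + 1), i₁ ≠ 0 → ∀ x ∈ liftDomain ψ i₁.succ, η x = residueForm (E := E) ψ G Q x := by
    intro i₁ hi₁ x hx
    obtain ⟨Q', hQ', hQ'η⟩ := hchart i₁ hi₁
    have hQQ' : Q' = Q := eq_of_residueForm_eq_on_charts ψ hG hprime hd hψ hrange hjac hhol hdim hQ' hQ hQ'η hQη
    rw [hQ'η x hx, hQQ']
  -- the exceptional set is finite
  set S : Set M := {x | ∀ i₁ : Fin (m + 1), i₁ ≠ 0 → x ∉ liftDomain ψ i₁.succ} with hSdef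
  have hG0' : G ≠ 0 := hprime.ne_zero
  have hS : ∀ G' ∈ ({G} : Set (MvPolynomial (Fin (m + 2)) ℂ)), G'.IsHomogeneous G'.totalDegree := by
    rintro G' rfl; rwa [hG.totalDegree hG0']
  have hSfin : S.Finite := by
    have himg : ψ '' S ⊆ (fun t : ℂ ↦ Projectivization.mk ℂ (Fin.cons t (Pi.single (0 : Fin (m + 1)) (1 : ℂ)) :
        Fin (m + 2) → ℂ) (by intro h; have := congrFun h 1; simp at this)) '' (g.roots.toFinset : Set ℂ) := by
      rintro _ ⟨x, hx, rfl⟩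
      -- a representative `z` of `ψ x` with `z_l = 0` for `l ≥ 2`
      set z := (ψ x).rep with hz
      have hzne : z ≠ 0 := Projectivization.rep_nonzero _
      have hψz : ψ x = Projectivization.mk ℂ z hzne := (Projectivization.mk_rep _).symm
      have hzero : ∀ i₁ : Fin (m + 1), i₁ ≠ 0 → z i₁.succ = 0 := by
        intro i₁ hi₁
        by_contra hne
        exact hx i₁ hi₁ (by rw [mem_liftDomain_iff, hψz, stdChart_source, mk_mem_stdChartSource_iff]; exact hne)
      have hzG : MvPolynomial.eval z G = 0 := by
        have hmem : ψ x ∈ projZeroLocus {G} := hrange ▸ Set.mem_range_self x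
        rw [hψz, mem_projZeroLocus_mk_iff hS] at hmem
        exact hmem G rfl
      -- `z = z₀ e₀ + z₁ e₁` with `z₁ ≠ 0`
      have hzeq : z = Fin.cons (z 0) (Pi.single (0 : Fin (m + 1)) (z 1)) := by
        funext l
        refine Fin.cases rfl (fun i₁ ↦ ?_) l
        rw [Fin.cons_succ]
        by_cases hi₁ : i₁ = 0
        · subst hi₁; simp
        · rw [Pi.single_eq_of_ne hi₁, hzero i₁ hi₁]
      have hz1 : z 1 ≠ 0 := by
        intro h1
        have hz0 : z 0 ≠ 0 := by
          intro h0; apply hzne; rw [hzeq, h0, h1]; funext l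
          refine Fin.cases rfl (fun i₁ ↦ ?_) l
          simp
        have : z = (z 0) • (Pi.single (0 : Fin (m + 2)) (1 : ℂ)) := by
          rw [hzeq, h1]; funext l
          refine Fin.cases (by simp) (fun i₁ ↦ ?_) l
          simp
        rw [this, eval_smul_of_isHomogeneous hG] at hzG
        exact hG0 ((mul_eq_zero.mp hzG).resolve_left (pow_ne_zero _ hz0))
      set t : ℂ := z 0 / z 1 with ht
      have hzt : z = (z 1) • (Fin.cons t (Pi.single (0 : Fin (m + 1)) (1 : ℂ)) : Fin (m + 2) → ℂ) := by
        rw [hzeq]; funext l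
        refine Fin.cases ?_ (fun i₁ ↦ ?_) l
        · simp [ht, mul_div_cancel₀ _ hz1]
        · by_cases hi₁ : i₁ = 0
          · subst hi₁; simp
          · simp [Fin.cons_succ, Pi.single_eq_of_ne hi₁]
      have hgt : g.eval t = 0 := by
        rw [hg, ← mul_right_inj' (pow_ne_zero d hz1), mul_zero, ← eval_smul_of_isHomogeneous hG, ← hzt, hzG]
      refine ⟨t, ?_, ?_⟩
      · simpa [Multiset.mem_toFinset, Polynomial.mem_roots hg0] using hgt
      · rw [hψz]
        symm
        rw [Projectivization.mk_eq_mk_iff]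
        exact ⟨Units.mk0 (z 1) hz1, by rw [Units.smul_mk0, ← hzt]⟩
    exact Set.Finite.of_finite_image ((Set.toFinite _).image _ |>.subset himg) hψ.injective.injOn
  -- conclude by the extension lemma applied to `η - Res(QΩ/G)`
  have hQhol : IsHolomorphicInCharts (residueForm (E := E) ψ G Q) :=
    isHolomorphicInCharts_residueForm ψ hG hψ.continuous hrange.le hjac hhol hQ hd
  have hdiff : IsHolomorphicInCharts (η + -residueForm (E := E) ψ G Q) := hη.add hQhol.neg
  funext x
  have hoff : ∀ y ∉ S, (η + -residueForm (E := E) ψ G Q) y = 0 := by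
    intro y hy
    simp only [hSdef, Set.mem_setOf_eq, not_forall, not_not] at hy
    obtain ⟨i₁, hi₁, hyi⟩ := hy
    change η y + -residueForm (E := E) ψ G Q y = 0
    rw [hall i₁ hi₁ y hyi, add_neg_cancel]
  have h0 := eq_zero_of_eq_zero_off_finite hdim hdiff hSfin hoff x
  change η x + -residueForm (E := E) ψ G Q x = 0 at h0
  rwa [add_neg_eq_zero] at h0

/-- **`dim_ℂ Ω^m(M) ≤ dim S^{d-m-2} = C(d-1, m+1)`** for a smooth hypersurface model in transversal normal form: the
holomorphic `m`-forms lie in the image of `S^{d-m-2}` under the linear map `Q ↦ ψ^* Res(QΩ/G)`.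
[cite: VoisinHodgeII2003, §6.1.3 Cor. 6.12 (p = 1)] [cite: Arapura2012, §17.3 (17.3.1)] -/
theorem finrank_holFormsInCharts_le [CompactSpace M] [Nonempty M] [NeZero m] (hG : G.IsHomogeneous d)
    (hprime : Prime G) (hψ : Topology.IsEmbedding ψ) (hrange : Set.range ψ = projZeroLocus {G})
    (hjac : ∀ z : Fin (m + 2) → ℂ, z ≠ 0 → MvPolynomial.eval z G = 0 →
      ∃ j, MvPolynomial.eval z (MvPolynomial.pderiv j G) ≠ 0)
    (hhol : HasHolomorphicCoords E ψ) (hdim : Module.finrank ℂ E = m) (hd : m + 2 ≤ d)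
    (hG0 : MvPolynomial.eval (Pi.single (0 : Fin (m + 2)) (1 : ℂ)) G ≠ 0) {g : ℂ[X]} (hg0 : g ≠ 0)
    (hg : ∀ t : ℂ, g.eval t = MvPolynomial.eval (Fin.cons t (Pi.single (0 : Fin (m + 1)) (1 : ℂ)) : Fin (m + 2) → ℂ) G)
    (hsimple : ∀ t : ℂ, g.eval t = 0 → (Polynomial.derivative g).eval t ≠ 0) :
    Module.finrank ℂ ↥(holFormsInCharts E M m) ≤ Nat.choose (d - 1) (m + 1) := by
  classical
  set k := d - (m + 2) with hk
  -- the residue map on `S^k`, landing in the holomorphic forms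
  let L : MvPolynomial (Fin (m + 2)) ℂ →ₗ[ℂ] MForm 𝓘(ℝ, E) M ℂ m :=
    { toFun := fun P ↦ residueForm (E := E) ψ G (MvPolynomial.homogeneousComponent k P)
      map_add' := fun P P' ↦ by rw [map_add, residueForm_add]
      map_smul' := fun c P ↦ by rw [map_smul, residueForm_smul]; rfl }
  have hle : holFormsInCharts E M m ≤ (MvPolynomial.homogeneousSubmodule (Fin (m + 2)) ℂ k).map L := by
    intro η hη
    obtain ⟨Q, hQ, hQη⟩ := exists_eq_residueForm ψ hG hprime hψ hrange hjac hhol hdim hd hG0 hg0 hg hsimple hη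
    refine ⟨Q, (MvPolynomial.mem_homogeneousSubmodule _ _).mpr hQ, ?_⟩
    change residueForm (E := E) ψ G (MvPolynomial.homogeneousComponent k Q) = η
    rw [MvPolynomial.homogeneousComponent_eq_self hQ, hQη]
  haveI : Module.Finite ℂ ↥(MvPolynomial.homogeneousSubmodule (Fin (m + 2)) ℂ k) :=
    Module.Finite.iff_fg.mpr (MvPolynomial.homogeneousSubmodule_fg (Fin (m + 2)) ℂ _)
  calc Module.finrank ℂ ↥(holFormsInCharts E M m)
      ≤ Module.finrank ℂ ↥((MvPolynomial.homogeneousSubmodule (Fin (m + 2)) ℂ k).map L) :=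
        Submodule.finrank_mono hle
    _ ≤ Module.finrank ℂ ↥(MvPolynomial.homogeneousSubmodule (Fin (m + 2)) ℂ k) := Submodule.finrank_map_le L _
    _ = Nat.choose (d - 1) (m + 1) := finrank_homogeneousSubmodule_sub_eq_choose hd

end Summit.HodgeConjecture.HodgeConjecture.Theorems.SmoothHypersurfaceTopFormsResidues

end
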